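import Summits.ResolutionOfSingularities.ResolutionOfSingularities.Theorems.WeightedInvariantIotaOrdEpsTauUpperSemicontinuousLE
import Summits.ResolutionOfSingularities.ResolutionOfSingularities.Theorems.WeightedInvariantContactCylinderGlobalMoveChevalley
import Summits.ResolutionOfSingularities.ResolutionOfSingularities.Theorems.WeightedInvariantTieFiniteTopology
import HarnessLib

/-!
# THE TIE PRIMES OF A REGULAR ALGEBRA OF FINITE TYPE OVER A PERFECT FIELD ARE FINITELY MANY — in EVERY dimension
# (door `HypersurfaceCentreConstruction`, stmt-ResolutionOfSingularities-19897; P3 rung `stub_keyRungGrHomLE_three`, letter `τ`; the τ-layer of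
# the graded clause hgr `IotaUpperSemicontinuousGradedLE 3 p iotaFlatT`)

Topic: `Summits/ResolutionOfSingularities/ResolutionOfSingularities/Theorems`. Helper for the door item `HypersurfaceCentreConstruction`
(stmt-ResolutionOfSingularities-19897, route `WeightedInvariant`), line `local-engine`, def-free.  Ring-level, dimension-free form of
`TieFinite.tiePoints_finite` (…IotaOrdEpsTauUpperSemicontinuousLE, smooth threefolds): for `A` a REGULAR ring of finite type over a perfect field `k₀`
and `F ∈ A`, the primes `𝔮` at which `(A_𝔮, F/1)` is a tie position (`Iota3.IsTiePosition`: `A_𝔮` regular of dimension `3`, …) are finitely many —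
`A` may have any dimension (e.g. the graded charts `A` of dimension `3 + j` of the clause hgr, whose HOMOGENEOUS tie primes are therefore finitely
many).  Proof: the curve prime `P₁ = P₀(A_𝔮, F) ∩ A` of a tie prime `𝔮` of order `n` is a MAXIMAL POINT of the closed set `{n ≤ ord}` of `Spec A`
(`ContactCylinder.isClosed_setOf_le_iotaOrd_atPrime`) with `ord_{A_{P₁}} F = n`; such points are finitely many for each `n`
(`TieFinite.finite_setOf_isMaximalIn`), the orders are bounded (`TieFinite.exists_forall_eq_of_antitone_closeds`), and over each such `P₁` the tie
primes of order `n` are finitely many (`TieFinite.finite_tiePrimes_over_of_maximal`, from (Δ10-d) `finite_tiePrimes_over`).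

* **`TieFinite.finite_tiePrimes_global`**.

[OURS · L1 W4.3 · letter τ]  Replaces the role of NO printed item; NOT a statement of the manuscript under review [claim: Hironaka2017, status:
under-review]; candidates stay candidates; AI work, weaker than expert review.  No definition; no axiom.

## References

* D. Abramovich, M. H. Quek, B. Schober, arXiv:2507.01232 (2025), Thm 1.3 (3), Thm 3.5. [AbramovichQuekSchober2025]
* H. Matsumura, *Commutative Ring Theory* (1986), Thm. 4.3, §30. [Matsumura1987]
-/

noncomputable section

set_option linter.dupNamespace false -- mandated namespace `Summit.<Summit>.<Problem>` of this single-conjunct summit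

open IsLocalRing Literature.AlgebraicGeometry.Resolution Topology
open Summit.ResolutionOfSingularities.ResolutionOfSingularities.Theorems
open Summit.ResolutionOfSingularities.ResolutionOfSingularities.Theorems.ContactCylinder

namespace Summit.ResolutionOfSingularities.ResolutionOfSingularities.Cruxes.HypersurfaceCentreConstruction.LocalEngine

namespace TieFinite

open Iota3

/-- **At a tie prime `𝔮`: its order `n`, and its curve prime `P₁ = P₀(A_𝔮) ∩ A` — below `𝔮`, of order `n`, and MAXIMAL among the primes of
order `≥ n` below it** (every prime `P' ≤ P₁` with `n ≤ ord_{A_{P'}} F` equals `P₁`). [OURS] -/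
theorem exists_curvePrime_of_tiePrime {A : Type} [CommRing A] (F : A) (𝔮 : Ideal A) [𝔮.IsPrime]
    (htie : IsTiePosition (Localization.AtPrime 𝔮) (algebraMap A (Localization.AtPrime 𝔮) F)) :
    ∃ (n : ℕ) (P₁ : Ideal A) (_ : P₁.IsPrime), P₁ ≤ 𝔮 ∧
      iotaOrd (Localization.AtPrime 𝔮) (algebraMap A (Localization.AtPrime 𝔮) F) = n ∧
      iotaOrd (Localization.AtPrime P₁) (algebraMap A (Localization.AtPrime P₁) F) = n ∧
      ∀ (P' : Ideal A) [P'.IsPrime], P' ≤ P₁ →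
        (n : Ordinal.{0}) ≤ iotaOrd (Localization.AtPrime P') (algebraMap A (Localization.AtPrime P') F) → P' = P₁ := by
  obtain ⟨ν, hP₀, hνeq, hνP₀, hdrop⟩ := IsTiePosition.iotaOrd_localization_lt htie
  set P₀ := topStratumPrime iotaOrdEps (Localization.AtPrime 𝔮) (algebraMap A (Localization.AtPrime 𝔮) F) with hP₀def
  haveI := hP₀
  refine ⟨ν, P₀.comap (algebraMap A (Localization.AtPrime 𝔮)), inferInstance,
    comap_le_of_isLocalization_atPrime 𝔮 (Localization.AtPrime 𝔮) P₀, hνeq, ?_, ?_⟩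
  · rw [← StratumIff.iota_localization_localization_eq iotaOrd iotaOrd_isoInvariant 𝔮 P₀ F]
    exact hνP₀
  · intro P' _ hle hn
    -- `Q' = P' A_𝔮` is a prime of `A_𝔮` of order `≥ n`, hence above `P₀`
    have hle𝔮 : P' ≤ 𝔮 := hle.trans (comap_le_of_isLocalization_atPrime 𝔮 (Localization.AtPrime 𝔮) P₀)
    haveI := isPrime_map_atPrime_of_le P' 𝔮 hle𝔮
    have hνQ' : (ν : Ordinal.{0}) ≤ iotaOrd (Localization.AtPrime (P'.map (algebraMap A (Localization.AtPrime 𝔮))))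
        (algebraMap (Localization.AtPrime 𝔮) _ (algebraMap A (Localization.AtPrime 𝔮) F)) := by
      rw [StratumIff.iota_localization_localization_eq iotaOrd iotaOrd_isoInvariant 𝔮 _ F,
        StratumIff.iota_localization_congr iotaOrd (comap_map_atPrime_of_le P' 𝔮 hle𝔮) F]
      exact hn
    have hP₀Q' : P₀ ≤ P'.map (algebraMap A (Localization.AtPrime 𝔮)) := by
      by_contra hnot
      exact absurd (hdrop _ hnot) (not_lt.mpr hνQ')
    refine le_antisymm hle ?_
    calc P₀.comap (algebraMap A (Localization.AtPrime 𝔮))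
        ≤ (P'.map (algebraMap A (Localization.AtPrime 𝔮))).comap (algebraMap A (Localization.AtPrime 𝔮)) := Ideal.comap_mono hP₀Q'
      _ = P' := comap_map_atPrime_of_le P' 𝔮 hle𝔮

/-- **THE TIE PRIMES OF A REGULAR FINITE-TYPE ALGEBRA OVER A PERFECT FIELD ARE FINITELY MANY (every dimension).**  See the module docstring.
[OURS · letter τ] [cite: AbramovichQuekSchober2025, Thm 1.3 (3), Thm 3.5] -/
theorem finite_tiePrimes_global (k₀ : Type) [Field k₀] [PerfectField k₀]
    (A : Type) [CommRing A] [Algebra k₀ A] [Algebra.FiniteType k₀ A] [IsRegularRing A] (F : A) :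
    {𝔮 : PrimeSpectrum A | IsTiePosition (Localization.AtPrime 𝔮.asIdeal) (algebraMap A (Localization.AtPrime 𝔮.asIdeal) F)}.Finite := by
  classical
  haveI : IsNoetherianRing A := Algebra.FiniteType.isNoetherianRing k₀ A
  -- the closed super-level sets of the order and their maximal points
  set nu : PrimeSpectrum A → Ordinal.{0} := fun 𝔮 => iotaOrd (Localization.AtPrime 𝔮.asIdeal)
    (algebraMap A (Localization.AtPrime 𝔮.asIdeal) F) with hnu
  set Fcl : ℕ → Set (PrimeSpectrum A) := fun n => {𝔮 | (n : Ordinal.{0}) ≤ nu 𝔮} with hFcl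
  have hclosed : ∀ n, IsClosed (Fcl n) := fun n => isClosed_setOf_le_iotaOrd_atPrime k₀ A F n
  set M : ℕ → Set (PrimeSpectrum A) := fun n => {P | P ∈ Fcl n ∧ ∀ P' ∈ Fcl n, P' ⤳ P → P' = P} with hM
  have hMfin : ∀ n, (M n).Finite := fun n => finite_setOf_isMaximalIn (hclosed n)
  -- the curve primes of order exactly `n`
  set I : ℕ → Set (PrimeSpectrum A) := fun n => {P | P ∈ M n ∧ nu P = n} with hI
  have hIfin : ∀ n, (I n).Finite := fun n => (hMfin n).subset fun P hP => hP.1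
  -- over each curve prime of order `n`, the tie primes of order `n` are finitely many
  have hT : ∀ n, ∀ P ∈ I n, {𝔮 : PrimeSpectrum A | P.asIdeal ≤ 𝔮.asIdeal ∧
      IsTiePosition (Localization.AtPrime 𝔮.asIdeal) (algebraMap A (Localization.AtPrime 𝔮.asIdeal) F) ∧
      iotaOrd (Localization.AtPrime 𝔮.asIdeal) (algebraMap A (Localization.AtPrime 𝔮.asIdeal) F) = n}.Finite := by
    rintro n P ⟨⟨hPF, hPmax⟩, hPn⟩
    refine finite_tiePrimes_over_of_maximal k₀ A F P.asIdeal n hPn fun 𝔮' _ hlt => ?_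
    by_contra hge
    have hge' : (n : Ordinal.{0}) ≤ iotaOrd (Localization.AtPrime 𝔮') (algebraMap A (Localization.AtPrime 𝔮') F) := not_lt.mp hge
    have hmem : (⟨𝔮', inferInstance⟩ : PrimeSpectrum A) ∈ Fcl n := hge'
    have hsp : (⟨𝔮', inferInstance⟩ : PrimeSpectrum A) ⤳ P := (PrimeSpectrum.le_iff_specializes _ _).mp hlt.le
    have heq := hPmax _ hmem hsp
    exact absurd (congrArg PrimeSpectrum.asIdeal heq) (ne_of_lt hlt)
  -- the orders are bounded
  obtain ⟨N, hN⟩ := exists_forall_eq_of_antitone_closeds Fcl hclosed (fun n 𝔮 h𝔮 => by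
    have h𝔮' : ((n + 1 : ℕ) : Ordinal.{0}) ≤ nu 𝔮 := h𝔮
    exact le_trans (by exact_mod_cast Nat.le_succ n) h𝔮')
  -- every tie prime lies over a curve prime of its order, which is `< N + 1`
  refine ((Finset.range (N + 1)).finite_toSet.biUnion fun n _ => (hIfin n).biUnion fun P hP => hT n P hP).subset ?_
  intro 𝔮 h𝔮
  have htie : IsTiePosition (Localization.AtPrime 𝔮.asIdeal) (algebraMap A (Localization.AtPrime 𝔮.asIdeal) F) := h𝔮
  obtain ⟨n, P₁, hP₁, hle, hν𝔮, hνP₁, hmax⟩ := exists_curvePrime_of_tiePrime F 𝔮.asIdeal htie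
  have hP₁I : (⟨P₁, hP₁⟩ : PrimeSpectrum A) ∈ I n := by
    refine ⟨⟨le_of_eq hνP₁.symm, fun P' hP' hsp => ?_⟩, hνP₁⟩
    have hle' : P'.asIdeal ≤ P₁ := (PrimeSpectrum.le_iff_specializes _ _).mpr hsp
    exact PrimeSpectrum.ext (hmax P'.asIdeal hle' hP')
  have hnN : n < N + 1 := by
    by_contra hge
    have hNn : N ≤ n := by omega
    have h1 : (⟨P₁, hP₁⟩ : PrimeSpectrum A) ∈ Fcl n := le_of_eq hνP₁.symm
    rw [hN n hNn, ← hN (n + 1) (by omega)] at h1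
    have h2 : ((n + 1 : ℕ) : Ordinal.{0}) ≤ (n : ℕ) := by
      have h3 : ((n + 1 : ℕ) : Ordinal.{0}) ≤ nu ⟨P₁, hP₁⟩ := h1
      rwa [show nu ⟨P₁, hP₁⟩ = n from hνP₁] at h3
    exact absurd (by exact_mod_cast h2 : n + 1 ≤ n) (by omega)
  refine Set.mem_biUnion (Finset.mem_coe.mpr (Finset.mem_range.mpr hnN)) (Set.mem_biUnion hP₁I ?_)
  exact ⟨hle, htie, hν𝔮⟩

end TieFinite

end Summit.ResolutionOfSingularities.ResolutionOfSingularities.Cruxes.HypersurfaceCentreConstruction.LocalEngine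

end
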